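import Summits.ABC.IUTFork.Thm311RealIsmDHMoverAssembled
import Summits.ABC.IUTFork.Cor312RamifiedShellAnalytic
import HarnessLib

/-!
# [IUTchIII] Cor. 3.12, TEAM R: norm bookkeeping of `λ̂` at the boundary place `v₃ = (ζ₃ − 1)` of `ℚ(ζ₃)` —
# `‖λ̂‖² = p⁻¹`, odd powers are never `1`, and the sharp setting's off-`S` ideles are parity-protected

PROOF-ONLY file (0 definitions, 0 named facts) of the abc-iut cell (Cor. 3.12 STRATEGY TEAM R, seat
R2 = abc-iut-c312-15); TAKES NO SIDE on [IUTchIII] Cor. 3.12.  Support lemmas for the odd-parity assembled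
refutation `Cor312IdentifiedRamifiedAssembled` (the `p = 3` mirror of w5-d216's p427624/p427994):

* `norm_rescaledOf_lamHat_sq` — `‖λ̂‖² = p⁻¹` in the rescaled completion of `ℚ(ζ₃)` at `v₃` (`λ̂² = −3·ζ̂₃`,
  `‖ζ̂₃‖ = 1`, `norm_prime`): the odd powers `‖λ̂‖^{2k+1}` are the half-integral idele norms;
* `norm_ne_odd_zpow_of_eq_one` — a positive real `< 1` has no odd integer power equal to `1`;
* `norm_tq_ne_odd_of_not_mem_S` — at B1's sharp assembled setting (`q`-ideles units off `S`, p421805) the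
  odd-order hypothesis is unsatisfiable off `S`: at the boundary prime the off-`S` q-balls coincide with the
  log-shell (`= 𝒪_{v₃}`, p429288) and are fixed by every `ismDH` element — the complement of p430061's
  `ℚ(√7)` instance, where the unit idele off `S` DOES refute the identified-copies reading.

[cite: DupuyHilado2025, §4.9] [cite: ScholzeStix2018, §2.2 pp. 9–10] [cite: NeukirchANT1999, Ch. II
Prop. (5.5)] [claim: Mochizuki2012, status: disputed] for every [IUTchIII] locution.  Standard axioms.
-/

noncomputable section

open Metric Set Function
open scoped Pointwise TensorProduct

namespace Summit.ABC.IUTFork.Thm311.Real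

open Thm311 Cor312 Cor312Vol Literature.IUT.LogVolume Literature.IUT.LogThetaLattice
open Literature.NumberTheory.NumberFields Literature.NumberTheory.GaloisRepresentations.Ultrametric
open NumberField IsDedekindDomain
open Summit.ABC.IUTFork.RamifiedMover

/-! ## 1. The norm of `λ̂` in the rescaled completion: `‖λ̂‖² = p⁻¹` -/

section NormLam

/-- **`‖λ̂‖² = p⁻¹` in the rescaled completion of `ℚ(ζ₃)` at `v₃`** (`p = 3`): `λ̂² = −3·ζ̂₃` with `‖ζ̂₃‖ = 1`
(`ζ̂₃³ = 1`) and `‖3‖ = 3⁻¹` (`norm_prime`).  So `‖λ̂‖ = 3^{−1/2}` — the odd powers `‖λ̂‖^{2k+1}` are the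
half-integral idele norms at `v₃`. [cite: NeukirchANT1999, Ch. II Prop. (5.5)] -/
theorem norm_rescaledOf_lamHat_sq (p : ℕ) [Fact p.Prime] (hv : ((p : ℕ) : 𝓞 K3) ∈ v3.asIdeal)
    (hp3 : p = 3) :
    ‖RescaledCompletion.of K3 p v3 hv lamHat‖ ^ 2 = (p : ℝ)⁻¹ := by
  subst hp3
  let ι : K3 →+* RescaledCompletion K3 3 v3 hv :=
    (RescaledCompletion.of K3 3 v3 hv).toRingHom.comp (algebraMap K3 (v3.adicCompletion K3))
  set ζ : RescaledCompletion K3 3 v3 hv := ι zeta3 with hζdef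
  set ϖ : RescaledCompletion K3 3 v3 hv := ι lam with hϖdef
  have hζ3 : ζ ^ 3 = 1 := by rw [hζdef, ← map_pow, zeta3_pow_three, map_one]
  have hϖsq : ϖ ^ 2 = -3 * ζ := by
    have h := congrArg ι lam_sq
    rwa [map_pow, map_mul, map_neg, map_ofNat] at h
  have h3 : ‖(3 : RescaledCompletion K3 3 v3 hv)‖ = (3 : ℝ)⁻¹ := by
    have h := norm_prime 3 (RescaledCompletion K3 3 v3 hv)
    rwa [Nat.cast_ofNat, Nat.cast_ofNat] at h
  have hζ1 : ‖ζ‖ = 1 :=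
    (pow_eq_one_iff_of_nonneg (norm_nonneg ζ) three_ne_zero).mp (by rw [← norm_pow, hζ3, norm_one])
  have heq : RescaledCompletion.of K3 3 v3 hv lamHat = ϖ := by
    rw [hϖdef]
    show RescaledCompletion.of K3 3 v3 hv (coeHom v3 lam) = ι lam
    rw [coeHom_apply]
    rfl
  rw [heq, ← norm_pow, hϖsq, norm_mul, norm_neg, h3, hζ1, mul_one]
  norm_num

/-- A positive real `< 1` has no odd integer power equal to `1` — the tightness side: norms `= 1` (the
sharp setting's off-`S` ideles) are never of odd `λ̂`-order. [folklore] -/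
theorem norm_ne_odd_zpow_of_eq_one {r : ℝ} (h0 : 0 < r) (h1 : r < 1) (k : ℤ) :
    (1 : ℝ) ≠ r ^ (2 * k + 1) := by
  intro h
  have hne : r ≠ 1 := h1.ne
  have : r ^ (2 * k + 1) < r ^ (0 : ℤ) ∨ r ^ (0 : ℤ) < r ^ (2 * k + 1) := by
    rcases lt_trichotomy (2 * k + 1) 0 with hk | hk | hk
    · exact Or.inr (zpow_lt_zpow_right_of_lt_one₀ h0 h1 hk)
    · omega
    · exact Or.inl (zpow_lt_zpow_right_of_lt_one₀ h0 h1 hk)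
  rw [zpow_zero] at this
  rcases this with h' | h' <;> rw [← h] at h' <;> exact lt_irrefl _ h'

end NormLam

/-- **The off-`S` ideles of the sharp setting are parity-protected at `p = 3`**: for `v₃ ∉ X.S` the sharp
idele norm is `1` — an EVEN `λ̂`-power — so the odd-order hypothesis of
`not_identifiedReading_identify_settingDHVolSharp_of_odd_zeta3` can only hold at a place of `X.S`.  This is
the precise boundary-prime complement of p430061 (`F = ℚ(√7)`, where the UNIT idele off `S` refutes the
reading): at `p = 3` the log-shell coincides with the unit ball (p429288), the q-ball of a unit idele IS the
shell, and every `ismDH` element fixes it. [cite: DupuyHilado2025, §4.9] -/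
theorem norm_tq_ne_odd_of_not_mem_S (X : PilotData K3)
    (tq : ∀ (pp : Nat.Primes) (x : (thetaIndex X).Fibre (.inr pp)),
      haveI : Fact (pp : ℕ).Prime := ⟨pp.2⟩; kOf X pp.1 x)
    (htq1 : ∀ (pp : Nat.Primes) (x : (thetaIndex X).Fibre (.inr pp)),
      haveI : Fact (pp : ℕ).Prime := ⟨pp.2⟩; placeOf X pp.1 x ∉ X.S → ‖tq pp x‖ = 1)
    (pp : Nat.Primes) (hv₀ : (thetaIndex X).over (.inr v3) = .inr pp) (hS : v3 ∉ X.S) (k : ℤ) :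
    haveI : Fact (pp : ℕ).Prime := ⟨pp.2⟩;
      ‖tq pp ⟨.inr v3, hv₀⟩‖ ≠
        ‖RescaledCompletion.of K3 pp v3 (natCast_mem_placeOf X pp ⟨.inr v3, hv₀⟩) lamHat‖ ^ (2 * k + 1) := by
  haveI hpF : Fact (pp : ℕ).Prime := ⟨pp.2⟩
  have hres : residueChar K3 v3 = (pp : ℕ) := congrArg Subtype.val (Sum.inr.inj hv₀)
  have hp3 : (pp : ℕ) = 3 := by rw [← hres, residueChar_v3]
  have hv : ((pp : ℕ) : 𝓞 K3) ∈ v3.asIdeal := natCast_mem_placeOf X pp ⟨.inr v3, hv₀⟩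
  obtain ⟨h0, h1⟩ := IsmDHMover.norm_pos_and_lt_one (norm_rescaledOf_lamHat_sq pp hv hp3)
  rw [htq1 pp ⟨.inr v3, hv₀⟩ hS]
  exact norm_ne_odd_zpow_of_eq_one h0 h1 k

/-- **Spelling bridge between the tree's two odd-order hypotheses at `v₃`** (the parallel threads landed
name-disjoint, 09:41Z dedup line of record): `‖x‖ = ‖λ̂‖^{2k+1}` — the form of
`Cor312IdentifiedRamifiedAssembled.not_identifiedReading_identify_settingDHVol_of_odd_zeta3` — is
equivalent to the squared form `‖x‖² = (p⁻¹)^{2k+1}` of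
`Cor312RamifiedMoverAssembled.not_identifiedReading_identify_settingDHVol_of_odd_v3`, by `‖λ̂‖² = p⁻¹`
and injectivity of squaring on nonnegatives.  Consumers may instantiate either family from either
hypothesis. [folklore] -/
theorem norm_eq_odd_zpow_iff_sq (p : ℕ) [Fact p.Prime] (hv : ((p : ℕ) : 𝓞 K3) ∈ v3.asIdeal)
    (hp3 : p = 3) {r : ℝ} (hr : 0 ≤ r) (k : ℤ) :
    r = ‖RescaledCompletion.of K3 p v3 hv lamHat‖ ^ (2 * k + 1) ↔
      r ^ 2 = ((p : ℝ)⁻¹) ^ (2 * k + 1) := by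
  have hsq := norm_rescaledOf_lamHat_sq p hv hp3
  obtain ⟨h0, h1⟩ := IsmDHMover.norm_pos_and_lt_one hsq
  set w : ℝ := ‖RescaledCompletion.of K3 p v3 hv lamHat‖ with hw
  have key : (w ^ (2 * k + 1)) ^ 2 = ((p : ℝ)⁻¹) ^ (2 * k + 1) := by
    rw [← hsq, ← zpow_natCast (w ^ (2 * k + 1)) 2, ← zpow_mul, ← zpow_natCast w 2, ← zpow_mul,
      mul_comm]
  constructor
  · intro h
    rw [h, key]
  · intro h
    have h2 : r ^ 2 = (w ^ (2 * k + 1)) ^ 2 := by rw [key]; exact h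
    have h3 := congrArg Real.sqrt h2
    rwa [Real.sqrt_sq hr, Real.sqrt_sq (zpow_nonneg h0.le _)] at h3

end Summit.ABC.IUTFork.Thm311.Real

end
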